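import Literature.Analysis.FluidPDE.PassiveScalarExistenceProofs
import Literature.Analysis.FluidPDE.PassiveScalarReleaseBounded
import Literature.Analysis.FunctionSpaces.SpaceTimeWeakCompactness
import HarnessLib

/-!
# Vanishing-diffusivity limits of weak passive scalars: passage to the limit `κₙ → κ`,
# boundedness of weak limits, and the slab form of weak lower semicontinuity

Analysis/FluidPDE proof-support file (everything proved; no definitions, no named facts). Three
generic steps of the vanishing-diffusivity argument for the passive scalar equation
`∂ₜθ + u·∇θ = κΔθ` on `T^d × [0,T)` along a FIXED bounded divergence-free drift `u`, in the
tree's vocabulary `Torus.IsWeakScalarTransportOn` (which covers the transport equation `κ = 0`):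

* `IsWeakScalarTransportOn.of_tendsto_diffusivity` — if `θₙ` are weak solutions with
  diffusivities `κₙ → κ` (e.g. `κₙ ↓ 0`), the same datum, uniformly bounded in `L^∞(0,T; L²)`, and
  `θₙ ⇀ W` weakly in `L²((0,T) × T^d)`, then `W` is a weak solution with diffusivity `κ` (for
  `κ = 0`: a weak solution of the TRANSPORT equation) — DiPerna–Lions' "we may pass to the limit
  since the equation is linear", here in the diffusivity instead of the drift (the tree's
  `IsWeakScalarTransportOn.of_tendsto` moves the drift at fixed `κ`);
* `Torus.ae_abs_le_of_weakLimit` — a.e. sup bounds `|θₙ| ≤ H` pass to weak limits (two-sided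
  form of the tree's `Torus.ae_le_of_weakLimit`, with the bound assumed at a.e. `(t, x)` rather
  than at every `x`);
* `Torus.setIntegral_integral_sq_le_of_weakLimit` — the slab form of weak lower semicontinuity
  of the `L²` norm used in energy arguments: if `∫_{(t₁,T)} ∫ θₙ² ≤ K` for all `n` and `θₙ ⇀ W`,
  then `∫_{(t₁,T)} ∫ W² ≤ K` (test the weak convergence against `1_{(t₁,T)} W` and Cauchy–Schwarz).

These are the ingredients of Bagnara–Boutros–De Lellis–Mayboroda's derivation "renormalisation
property ⇒ no dissipation anomaly" (arXiv:2603.11466, Thm. 3.1), formalised in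
`Literature/Barriers/AnomalousDissipation/RenormalisationNoAnomaly.lean`.

## Mathlib / tree search

Tree: `PassiveScalarExistenceProofs` (`IsWeakScalarTransportOn.of_tendsto`, whose proof is
followed line by line), `PassiveScalarReleaseBounded` (`Torus.ae_le_of_weakLimit`),
`SpaceTimeWeakCompactness` (`memLp_two_uncurry`, `inner_toLp_uncurry_eq`, the weak-* extraction
these lemmas are fed by), `PassiveScalarProofs` (class bookkeeping). Mathlib: `real_inner_le_norm`,
`Measure.ae_prod_iff_ae_ae`, `Measure.ae_ae_of_ae_prod`.

## References

* R. J. DiPerna, P.-L. Lions, Invent. Math. 98 (1989), Prop. II.1 and its proof, Thm. II.4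
  (stability). [`DiPernaLions1989`]
* M. Bagnara, D. W. Boutros, C. De Lellis, S. Mayboroda, arXiv:2603.11466 (2026), §3.1, proof of
  Thm. 3.1 (pp. 11–12). [`BagnaraEtAl2026`]
* H. Brezis, *Functional Analysis, Sobolev Spaces and PDE*, Springer 2011, Prop. 3.5 (iii) (weak
  lower semicontinuity of the norm). [`Brezis2011`]
-/

noncomputable section

open _root_.MeasureTheory _root_.TopologicalSpace _root_.Set _root_.Function _root_.Filter
open _root_.Topology
open scoped ENNReal NNReal InnerProductSpace

namespace Literature.Analysis.FluidPDE

namespace Torus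

variable {d : Type*} [Fintype d]

/-! ## Passage to the limit in the diffusivity -/

section Diffusivity

variable {T κ : ℝ} {C : ℝ≥0} {u : ℝ → UnitAddTorus d → EuclideanSpace ℝ d} {κs : ℕ → ℝ}
  {θ₀ : UnitAddTorus d → ℝ} {θ : ℕ → ℝ → UnitAddTorus d → ℝ} {W : ℝ → UnitAddTorus d → ℝ}

/-- **Stability of weak passive scalars under weak-* convergence with varying diffusivity**
(DiPerna–Lions 1989, proof of Prop. II.1: "we may pass to the limit … since the equation is
linear"; Bagnara–Boutros–De Lellis–Mayboroda 2026, proof of Thm. 3.1: "passing to the limit in the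
weak formulation (2.2), θ is a bounded distributional solution"). Let `θₙ` be weak solutions of
`∂ₜθₙ + u·∇θₙ = κₙ Δθₙ` on `T^d × [0,T)` with the SAME datum `θ₀` along the SAME drift
`u ∈ L^∞((0,T) × T^d)` (weakly divergence free at a.e. time), uniformly bounded in `L^∞(0,T; L²)`,
and let `W` be a field of the same class to which `θₙ` converges weakly in `L²((0,T) × T^d)`. If
`κₙ → κ`, then `W` is a weak solution with diffusivity `κ` and datum `θ₀`; for `κ = 0` this is a
weak solution of the transport equation. [cite: DiPernaLions1989, Prop. II.1, proof]
[cite: BagnaraEtAl2026, §3.1 (proof of Thm. 3.1)] -/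
theorem IsWeakScalarTransportOn.of_tendsto_diffusivity
    (hsol : ∀ n, IsWeakScalarTransportOn T (κs n) u θ₀ (θ n))
    (hbd : ∀ n, ∀ᵐ t ∂(volume.restrict (Ioo 0 T)), ∫⁻ x, ‖θ n t x‖ₑ ^ 2 ≤ C)
    (hWm : AEStronglyMeasurable (FunctionSpaces.Torus.stLift W) (volume.restrict (Ioo 0 T ×ˢ univ)))
    (hWb : ∀ᵐ t ∂(volume.restrict (Ioo 0 T)), ∫⁻ x, ‖W t x‖ₑ ^ 2 ≤ C)
    (hlim : ∀ G : ℝ → UnitAddTorus d → ℝ,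
      AEStronglyMeasurable (FunctionSpaces.Torus.stLift G) (volume.restrict (Ioo 0 T ×ˢ univ)) →
      ∫⁻ t in Ioo 0 T, ∫⁻ x, ‖G t x‖ₑ ^ 2 < ⊤ →
      Tendsto (fun n => ∫ t in Ioo 0 T, ∫ x, θ n t x * G t x) atTop
        (𝓝 (∫ t in Ioo 0 T, ∫ x, W t x * G t x)))
    (hu : MemLp (FunctionSpaces.Torus.stLift u) ⊤ (volume.restrict (Ioo 0 T ×ˢ univ)))
    (hdiv : ∀ᵐ t ∂(volume.restrict (Ioo 0 T)), FunctionSpaces.Torus.IsWeaklyDivFree (u t))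
    (hκ : Tendsto κs atTop (𝓝 κ)) :
    IsWeakScalarTransportOn T κ u θ₀ W := by
  set μ : Measure (ℝ × UnitAddTorus d) :=
    ((volume : Measure ℝ).restrict (Ioo 0 T)).prod (volume : Measure (UnitAddTorus d)) with hμ
  haveI : IsFiniteMeasure ((volume : Measure ℝ).restrict (Ioo 0 T)) :=
    isFiniteMeasure_restrict.2 measure_Ioo_lt_top.ne
  haveI : IsFiniteMeasure μ := by rw [hμ]; infer_instance
  -- the drift: a.e. bounds and measurability
  obtain ⟨Cu, hCu0, hCu⟩ := ae_norm_le_prod_of_memLp_top_stLift hu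
  obtain ⟨Cu', -, hCu'⟩ := ae_ae_norm_le_of_memLp_top_stLift hu
  have hum : AEStronglyMeasurable (uncurry u) μ :=
    FunctionSpaces.Torus.aestronglyMeasurable_uncurry_of_stLift_prod hu.1
  have hWm' : AEStronglyMeasurable (uncurry W) μ :=
    FunctionSpaces.Torus.aestronglyMeasurable_uncurry_of_stLift_prod hWm
  -- slice bounds: `∫⁻ ‖u t‖ₑ² ≤ Cu'²` for a.e. `t`
  have hu2 : ∀ᵐ t ∂(volume.restrict (Ioo 0 T)), ∫⁻ x, ‖u t x‖ₑ ^ 2 ≤ ENNReal.ofReal Cu' ^ 2 := by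
    filter_upwards [hCu'] with t ht
    calc ∫⁻ x, ‖u t x‖ₑ ^ 2 ≤ ∫⁻ _ : UnitAddTorus d, ENNReal.ofReal Cu' ^ 2 := by
          refine lintegral_mono_ae ?_
          filter_upwards [ht] with x hx
          gcongr
          rw [← ofReal_norm]
          exact ENNReal.ofReal_le_ofReal hx
      _ = ENNReal.ofReal Cu' ^ 2 := by rw [lintegral_const, measure_univ, mul_one]
  refine ⟨hWm, hu.1, ⟨C, hWb⟩, ?_, ?_, hdiv, fun ψ hψ => ?_⟩
  · -- `u ∈ L¹(0,T; L²)`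
    calc ∫⁻ t in Ioo 0 T, (∫⁻ x, ‖u t x‖ₑ ^ 2) ^ (1 / 2 : ℝ)
        ≤ ∫⁻ _ in Ioo 0 T, (ENNReal.ofReal Cu' ^ 2) ^ (1 / 2 : ℝ) := by
          refine lintegral_mono_ae ?_
          filter_upwards [hu2] with t ht
          exact ENNReal.rpow_le_rpow ht (by norm_num)
      _ < ⊤ := by
          rw [lintegral_const, Measure.restrict_apply_univ]
          exact ENNReal.mul_lt_top (ENNReal.rpow_lt_top_of_nonneg (by norm_num)
            (ENNReal.pow_ne_top ENNReal.ofReal_ne_top)) measure_Ioo_lt_top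
  · -- `u W ∈ L¹((0,T) × T^d)`
    have hWs : ∀ᵐ t ∂(volume.restrict (Ioo 0 T)), AEStronglyMeasurable (W t) volume := hWm'.prodMk_left
    calc ∫⁻ t in Ioo 0 T, ∫⁻ x, ‖u t x‖ₑ * ‖W t x‖ₑ
        ≤ ∫⁻ _ in Ioo 0 T, ENNReal.ofReal Cu' * (C : ℝ≥0∞) ^ (1 / 2 : ℝ) := by
          refine lintegral_mono_ae ?_
          filter_upwards [hCu', hWb, hWs] with t ht htW htm
          calc ∫⁻ x, ‖u t x‖ₑ * ‖W t x‖ₑ ≤ ∫⁻ x, ENNReal.ofReal Cu' * ‖W t x‖ₑ := by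
                refine lintegral_mono_ae ?_
                filter_upwards [ht] with x hx
                gcongr
                rw [← ofReal_norm]
                exact ENNReal.ofReal_le_ofReal hx
            _ = ENNReal.ofReal Cu' * eLpNorm (W t) 1 volume := by
                rw [lintegral_const_mul' _ _ ENNReal.ofReal_ne_top, eLpNorm_one_eq_lintegral_enorm]
            _ ≤ ENNReal.ofReal Cu' * eLpNorm (W t) 2 volume := by
                gcongr
                exact eLpNorm_le_eLpNorm_of_exponent_le one_le_two htm
            _ ≤ ENNReal.ofReal Cu' * (C : ℝ≥0∞) ^ (1 / 2 : ℝ) := by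
                gcongr
                rw [FunctionSpaces.eLpNorm_two_eq_pow_two_rpow_half, FunctionSpaces.eLpNorm_two_pow_two_eq_lintegral]
                exact ENNReal.rpow_le_rpow htW (by norm_num)
      _ < ⊤ := by
          rw [lintegral_const, Measure.restrict_apply_univ]
          exact ENNReal.mul_lt_top (ENNReal.mul_lt_top ENNReal.ofReal_lt_top
            (ENNReal.rpow_lt_top_of_nonneg (by norm_num) ENNReal.coe_ne_top)) measure_Ioo_lt_top
  · -- the weak formulation in the limit
    set G : ℝ → UnitAddTorus d → ℝ := fun t x =>
      FunctionSpaces.Torus.timeDeriv ψ t x + ⟪u t x, FunctionSpaces.Torus.gradient (ψ t) x⟫_ℝ +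
        κ * FunctionSpaces.Torus.laplacian (ψ t) x with hG
    set H : ℕ → ℝ → UnitAddTorus d → ℝ := fun n t x =>
      (κs n - κ) * FunctionSpaces.Torus.laplacian (ψ t) x with hH
    change (∫ t in Ioo 0 T, ∫ x, W t x * G t x) + ∫ x, θ₀ x * ψ 0 x = 0
    -- bounds on the test function
    obtain ⟨C₁, hC₁⟩ := exists_bound_of_continuous_uncurry hψ.continuous_uncurry_timeDeriv 0 T
    obtain ⟨C₂, hC₂⟩ := exists_bound_of_continuous_uncurry hψ.continuous_uncurry_gradient 0 T
    obtain ⟨C₃, hC₃⟩ := exists_bound_of_continuous_uncurry hψ.continuous_uncurry_laplacian 0 T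
    have hae : ∀ᵐ p ∂μ, p.1 ∈ Ioo 0 T :=
      (Measure.quasiMeasurePreserving_fst (μ := (volume : Measure ℝ).restrict (Ioo 0 T))
        (ν := (volume : Measure (UnitAddTorus d)))).ae (ae_restrict_mem measurableSet_Ioo)
    -- `G` is bounded a.e. and measurable, hence square integrable, on `(0,T) × T^d`
    set M : ℝ := C₁ + Cu * C₂ + |κ| * C₃ with hM
    have hGbd : ∀ᵐ p ∂μ, ‖G p.1 p.2‖ ≤ M := by
      filter_upwards [hae, hCu] with p hp hpu
      have hp' : p.1 ∈ Icc 0 T := Ioo_subset_Icc_self hp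
      have h1 : ‖FunctionSpaces.Torus.timeDeriv ψ p.1 p.2‖ ≤ C₁ := hC₁ p.1 hp' p.2
      have h2 : ‖⟪u p.1 p.2, FunctionSpaces.Torus.gradient (ψ p.1) p.2⟫_ℝ‖ ≤ Cu * C₂ :=
        (norm_inner_le_norm _ _).trans (mul_le_mul hpu (hC₂ p.1 hp' p.2) (norm_nonneg _) hCu0)
      have h3 : ‖κ * FunctionSpaces.Torus.laplacian (ψ p.1) p.2‖ ≤ |κ| * C₃ := by
        rw [norm_mul, Real.norm_eq_abs]
        exact mul_le_mul_of_nonneg_left (hC₃ p.1 hp' p.2) (abs_nonneg _)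
      calc ‖G p.1 p.2‖ ≤ ‖FunctionSpaces.Torus.timeDeriv ψ p.1 p.2‖ +
            ‖⟪u p.1 p.2, FunctionSpaces.Torus.gradient (ψ p.1) p.2⟫_ℝ‖ + ‖κ * FunctionSpaces.Torus.laplacian (ψ p.1) p.2‖ :=
            norm_add₃_le
        _ ≤ M := add_le_add (add_le_add h1 h2) h3
    have hGm : AEStronglyMeasurable (uncurry G) μ := by
      change AEStronglyMeasurable (fun p : ℝ × UnitAddTorus d =>
        FunctionSpaces.Torus.timeDeriv ψ p.1 p.2 + ⟪u p.1 p.2, FunctionSpaces.Torus.gradient (ψ p.1) p.2⟫_ℝ +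
          κ * FunctionSpaces.Torus.laplacian (ψ p.1) p.2) μ
      refine ((?_ : AEStronglyMeasurable _ μ).add ?_).add ?_
      · exact hψ.continuous_uncurry_timeDeriv.aestronglyMeasurable
      · exact hum.inner hψ.continuous_uncurry_gradient.aestronglyMeasurable
      · exact (continuous_const.mul hψ.continuous_uncurry_laplacian).aestronglyMeasurable
    have hG2 : ∫⁻ t in Ioo 0 T, ∫⁻ x, ‖G t x‖ₑ ^ 2 < ⊤ := by
      have h1 : ∫⁻ p, ‖uncurry G p‖ₑ ^ 2 ∂μ ≤ ∫⁻ _, ENNReal.ofReal M ^ 2 ∂μ := by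
        refine lintegral_mono_ae ?_
        filter_upwards [hGbd] with p hp
        gcongr
        rw [← ofReal_norm]
        exact ENNReal.ofReal_le_ofReal hp
      rw [lintegral_prod _ (hGm.aemeasurable.enorm.pow_const 2)] at h1
      refine lt_of_le_of_lt h1 ?_
      rw [lintegral_const]
      exact ENNReal.mul_lt_top (ENNReal.pow_lt_top ENNReal.ofReal_lt_top) (measure_lt_top _ _)
    have hGst : AEStronglyMeasurable (FunctionSpaces.Torus.stLift G) (volume.restrict (Ioo 0 T ×ˢ univ)) :=
      FunctionSpaces.Torus.aestronglyMeasurable_stLift_of_uncurry hGm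
    -- (a) the weak convergence `∫∫ θₙ G → ∫∫ W G`
    have hA := hlim G hGst hG2
    -- (b) the splitting of the `n`-th weak identity
    have hθG : ∀ n, Integrable (fun p : ℝ × UnitAddTorus d => θ n p.1 p.2 * G p.1 p.2) μ := fun n =>
      (hsol n).integrable_uncurry.mul_bdd hGm hGbd
    have hθGn : ∀ n, Integrable (fun p : ℝ × UnitAddTorus d => θ n p.1 p.2 *
        (FunctionSpaces.Torus.timeDeriv ψ p.1 p.2 + ⟪u p.1 p.2, FunctionSpaces.Torus.gradient (ψ p.1) p.2⟫_ℝ +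
          κs n * FunctionSpaces.Torus.laplacian (ψ p.1) p.2)) μ := fun n =>
      (hsol n).integrable_weakIntegrand hψ
    have hsplit : ∀ n (p : ℝ × UnitAddTorus d), θ n p.1 p.2 *
        (FunctionSpaces.Torus.timeDeriv ψ p.1 p.2 + ⟪u p.1 p.2, FunctionSpaces.Torus.gradient (ψ p.1) p.2⟫_ℝ +
          κs n * FunctionSpaces.Torus.laplacian (ψ p.1) p.2) =
        θ n p.1 p.2 * G p.1 p.2 + θ n p.1 p.2 * H n p.1 p.2 := by
      intro n p
      simp only [hG, hH]
      ring
    have hθH : ∀ n, Integrable (fun p : ℝ × UnitAddTorus d => θ n p.1 p.2 * H n p.1 p.2) μ := by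
      intro n
      have h := (hθGn n).sub (hθG n)
      refine h.congr (Eventually.of_forall fun p => ?_)
      simp only [Pi.sub_apply, hsplit n p, add_sub_cancel_left]
    have hident : ∀ n, (∫ t in Ioo 0 T, ∫ x, θ n t x * G t x) =
        -(∫ p, θ n p.1 p.2 * H n p.1 p.2 ∂μ) - ∫ x, θ₀ x * ψ 0 x := by
      intro n
      have h0 := (hsol n).integral_prod_weak_eq hψ
      have h1 : (∫ p, θ n p.1 p.2 *
          (FunctionSpaces.Torus.timeDeriv ψ p.1 p.2 + ⟪u p.1 p.2, FunctionSpaces.Torus.gradient (ψ p.1) p.2⟫_ℝ +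
            κs n * FunctionSpaces.Torus.laplacian (ψ p.1) p.2) ∂μ) =
          (∫ p, θ n p.1 p.2 * G p.1 p.2 ∂μ) + ∫ p, θ n p.1 p.2 * H n p.1 p.2 ∂μ := by
        rw [← integral_add (hθG n) (hθH n)]
        exact integral_congr_ae (Eventually.of_forall fun p => hsplit n p)
      have h2 : (∫ p, θ n p.1 p.2 * G p.1 p.2 ∂μ) = ∫ t in Ioo 0 T, ∫ x, θ n t x * G t x :=
        integral_prod _ (hθG n)
      rw [h1, h2] at h0
      linarith
    -- (c) the diffusivity error `(κₙ - κ) ∫∫ θₙ Δψ → 0`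
    set B : ℝ≥0∞ := (C : ℝ≥0∞) * volume (Ioo (0 : ℝ) T) with hB
    have hBfin : B < ⊤ := ENNReal.mul_lt_top ENNReal.coe_lt_top measure_Ioo_lt_top
    have hθ1 : ∀ n, ∫⁻ p, ‖θ n p.1 p.2‖ₑ ∂μ ≤ B ^ (1 / 2 : ℝ) * (μ univ) ^ (1 / 2 : ℝ) := by
      intro n
      have hfin : ∫⁻ t in Ioo 0 T, ∫⁻ x, ‖θ n t x‖ₑ ^ 2 ≤ B :=
        calc ∫⁻ t in Ioo 0 T, ∫⁻ x, ‖θ n t x‖ₑ ^ 2 ≤ ∫⁻ _ in Ioo (0 : ℝ) T, (C : ℝ≥0∞) :=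
              lintegral_mono_ae (hbd n)
          _ = B := by rw [lintegral_const, Measure.restrict_apply_univ]
      have h := (FunctionSpaces.Torus.memLp_two_uncurry (hsol n).aestronglyMeasurable_uncurry (hfin.trans_lt hBfin)).2
      have hθ2 : eLpNorm (uncurry (θ n)) 2 μ ≤ B ^ (1 / 2 : ℝ) := by
        rw [FunctionSpaces.eLpNorm_two_eq_pow_two_rpow_half, h]
        exact ENNReal.rpow_le_rpow hfin (by norm_num)
      have h3 := eLpNorm_le_eLpNorm_mul_rpow_measure_univ (p := 1) (q := 2) (μ := μ) (by norm_num)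
        (hsol n).aestronglyMeasurable_uncurry
      rw [eLpNorm_one_eq_lintegral_enorm] at h3
      have hexp : (1 / (1 : ℝ≥0∞).toReal - 1 / (2 : ℝ≥0∞).toReal : ℝ) = 1 / 2 := by norm_num
      rw [hexp] at h3
      calc ∫⁻ p, ‖θ n p.1 p.2‖ₑ ∂μ = ∫⁻ p, ‖uncurry (θ n) p‖ₑ ∂μ := rfl
        _ ≤ eLpNorm (uncurry (θ n)) 2 μ * (μ univ) ^ (1 / 2 : ℝ) := h3
        _ ≤ B ^ (1 / 2 : ℝ) * (μ univ) ^ (1 / 2 : ℝ) := by gcongr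
    have hJbound : ∀ n, ‖∫ p, θ n p.1 p.2 * H n p.1 p.2 ∂μ‖ ≤
        |κs n - κ| * (ENNReal.ofReal C₃ * (B ^ (1 / 2 : ℝ) * (μ univ) ^ (1 / 2 : ℝ))).toReal := by
      intro n
      have h1 : ‖∫ p, θ n p.1 p.2 * H n p.1 p.2 ∂μ‖ ≤
          (∫⁻ p, ‖θ n p.1 p.2 * H n p.1 p.2‖ₑ ∂μ).toReal := by
        rw [← integral_norm_eq_lintegral_enorm (hθH n).1]
        exact norm_integral_le_integral_norm _
      refine h1.trans ?_
      have hfin2 : ENNReal.ofReal C₃ * (B ^ (1 / 2 : ℝ) * (μ univ) ^ (1 / 2 : ℝ)) ≠ ⊤ :=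
        ENNReal.mul_ne_top ENNReal.ofReal_ne_top (ENNReal.mul_ne_top
          (ENNReal.rpow_ne_top_of_nonneg (by norm_num) hBfin.ne)
          (ENNReal.rpow_ne_top_of_nonneg (by norm_num) (measure_ne_top _ _)))
      have h2 : ∫⁻ p, ‖θ n p.1 p.2 * H n p.1 p.2‖ₑ ∂μ ≤
          ENNReal.ofReal |κs n - κ| * (ENNReal.ofReal C₃ * ∫⁻ p, ‖θ n p.1 p.2‖ₑ ∂μ) := by
        rw [← lintegral_const_mul' _ _ ENNReal.ofReal_ne_top, ← lintegral_const_mul' _ _ ENNReal.ofReal_ne_top]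
        refine lintegral_mono_ae ?_
        filter_upwards [hae] with p hp
        have hp' : p.1 ∈ Icc 0 T := Ioo_subset_Icc_self hp
        rw [enorm_mul, hH]
        dsimp only
        rw [enorm_mul, ← ofReal_norm (κs n - κ), Real.norm_eq_abs, ← ofReal_norm (FunctionSpaces.Torus.laplacian _ _)]
        calc ‖θ n p.1 p.2‖ₑ * (ENNReal.ofReal |κs n - κ| * ENNReal.ofReal ‖FunctionSpaces.Torus.laplacian (ψ p.1) p.2‖)
            ≤ ‖θ n p.1 p.2‖ₑ * (ENNReal.ofReal |κs n - κ| * ENNReal.ofReal C₃) := by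
              gcongr
              exact hC₃ p.1 hp' p.2
          _ = ENNReal.ofReal |κs n - κ| * (ENNReal.ofReal C₃ * ‖θ n p.1 p.2‖ₑ) := by ring
      have h3 : ∫⁻ p, ‖θ n p.1 p.2 * H n p.1 p.2‖ₑ ∂μ ≤
          ENNReal.ofReal |κs n - κ| * (ENNReal.ofReal C₃ * (B ^ (1 / 2 : ℝ) * (μ univ) ^ (1 / 2 : ℝ))) :=
        h2.trans (by gcongr; exact hθ1 n)
      have h4 := ENNReal.toReal_mono (ENNReal.mul_ne_top ENNReal.ofReal_ne_top hfin2) h3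
      rw [ENNReal.toReal_mul, ENNReal.toReal_ofReal (abs_nonneg _)] at h4
      exact h4
    have hJ : Tendsto (fun n => ∫ p, θ n p.1 p.2 * H n p.1 p.2 ∂μ) atTop (𝓝 0) := by
      have hk0 : Tendsto (fun n => |κs n - κ|) atTop (𝓝 0) := by
        have h := (hκ.sub_const κ).abs
        rwa [sub_self, abs_zero] at h
      have hlim0 : Tendsto (fun n => |κs n - κ| *
          (ENNReal.ofReal C₃ * (B ^ (1 / 2 : ℝ) * (μ univ) ^ (1 / 2 : ℝ))).toReal) atTop (𝓝 0) := by
        simpa using hk0.mul_const _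
      exact squeeze_zero_norm (fun n => hJbound n) hlim0
    -- (d) conclusion: `∫∫ W G = lim ∫∫ θₙ G = -lim Jₙ - ∫ θ₀ ψ(0)`
    have hA' : Tendsto (fun n => ∫ t in Ioo 0 T, ∫ x, θ n t x * G t x) atTop
        (𝓝 (-(0 : ℝ) - ∫ x, θ₀ x * ψ 0 x)) :=
      (hJ.neg.sub tendsto_const_nhds).congr fun n => (hident n).symm
    rw [tendsto_nhds_unique hA hA']
    ring

end Diffusivity

/-! ## Sup bounds pass to weak limits (a.e. form) -/

section Bounds

/-- An iterated a.e. bound `∀ᵐ t, ∀ᵐ x, |θ t x| ≤ H` of a jointly a.e.-strongly measurable field is a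
product-a.e. bound. [folklore] -/
private theorem ae_prod_abs_le_of_ae_ae {T H : ℝ} {θ : ℝ → UnitAddTorus d → ℝ}
    (hθm : AEStronglyMeasurable (uncurry θ)
      (((volume : Measure ℝ).restrict (Ioo 0 T)).prod (volume : Measure (UnitAddTorus d))))
    (hθb : ∀ᵐ t ∂(volume.restrict (Ioo 0 T)), ∀ᵐ x ∂(volume : Measure (UnitAddTorus d)), |θ t x| ≤ H) :
    ∀ᵐ p ∂(((volume : Measure ℝ).restrict (Ioo 0 T)).prod (volume : Measure (UnitAddTorus d))),
      |θ p.1 p.2| ≤ H := by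
  set P := ((volume : Measure ℝ).restrict (Ioo 0 T)).prod (volume : Measure (UnitAddTorus d)) with hP
  set θ' : ℝ × UnitAddTorus d → ℝ := hθm.mk (uncurry θ) with hθ'
  have hθ'm : Measurable θ' := hθm.stronglyMeasurable_mk.measurable
  have hθθ' : uncurry θ =ᵐ[P] θ' := hθm.ae_eq_mk
  have hS : MeasurableSet {p : ℝ × UnitAddTorus d | |θ' p| ≤ H} :=
    measurableSet_le (continuous_abs.measurable.comp hθ'm) measurable_const
  have h1 : ∀ᵐ t ∂(volume.restrict (Ioo 0 T)), ∀ᵐ x ∂(volume : Measure (UnitAddTorus d)), |θ' (t, x)| ≤ H := by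
    filter_upwards [hθb, Measure.ae_ae_of_ae_prod hθθ'] with t ht ht'
    filter_upwards [ht, ht'] with x hx hx'
    simp only [uncurry] at hx'
    rw [← hx']; exact hx
  have h2 : ∀ᵐ p ∂P, |θ' p| ≤ H := by
    rw [hP, Measure.ae_prod_iff_ae_ae hS]
    exact h1
  filter_upwards [h2, hθθ'] with p hp hp'
  simp only [uncurry] at hp'
  rw [hp']; exact hp

/-- **Two-sided sup bounds pass to weak limits (a.e. form).** If `|θⱼ(t, x)| ≤ H` for a.e.
`t ∈ (0,T)` and a.e. `x`, and `θⱼ ⇀ W` in the sense that `∫∫ θⱼ G → ∫∫ W G` for every space–time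
square-integrable `G`, with `W ∈ L^∞(0,T; L²)` measurable, then `|W(t, x)| ≤ H` for a.e. `t` and
a.e. `x` (Bagnara–Boutros–De Lellis–Mayboroda 2026, proof of Thm. 3.1: "θ_ε is uniformly bounded
… up to subsequence, it converges weakly-∗ to some bounded function θ"; proof: clamp `θⱼ` to
`[-H, H]` — an a.e. modification, invisible to the pairings — and apply the tree's
`ae_le_of_weakLimit` to `±` the clamped fields). [cite: BagnaraEtAl2026, §3.1 (proof of Thm. 3.1)] -/
theorem ae_abs_le_of_weakLimit {T H : ℝ} {θ : ℕ → ℝ → UnitAddTorus d → ℝ} {W : ℝ → UnitAddTorus d → ℝ}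
    (hθm : ∀ j, AEStronglyMeasurable (FunctionSpaces.Torus.stLift (θ j)) (volume.restrict (Ioo 0 T ×ˢ univ)))
    (hθb : ∀ j, ∀ᵐ t ∂(volume.restrict (Ioo 0 T)), ∀ᵐ x ∂(volume : Measure (UnitAddTorus d)), |θ j t x| ≤ H)
    (hWm : AEStronglyMeasurable (FunctionSpaces.Torus.stLift W) (volume.restrict (Ioo 0 T ×ˢ univ)))
    {C : ℝ≥0} (hWb : ∀ᵐ t ∂(volume.restrict (Ioo 0 T)), ∫⁻ x, ‖W t x‖ₑ ^ 2 ≤ C)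
    (hlim : ∀ G : ℝ → UnitAddTorus d → ℝ,
      AEStronglyMeasurable (FunctionSpaces.Torus.stLift G) (volume.restrict (Ioo 0 T ×ˢ univ)) →
      ∫⁻ t in Ioo 0 T, ∫⁻ x, ‖G t x‖ₑ ^ 2 < ⊤ →
      Tendsto (fun j => ∫ t in Ioo 0 T, ∫ x, θ j t x * G t x) atTop (𝓝 (∫ t in Ioo 0 T, ∫ x, W t x * G t x))) :
    ∀ᵐ t ∂(volume.restrict (Ioo 0 T)), ∀ᵐ x ∂(volume : Measure (UnitAddTorus d)), |W t x| ≤ H := by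
  set μT : Measure ℝ := (volume : Measure ℝ).restrict (Ioo 0 T) with hμT
  set P : Measure (ℝ × UnitAddTorus d) := μT.prod volume with hP
  -- `H ≥ 0` unless the time interval is trivial
  by_cases hH : H < 0
  · -- then the hypothesis forces `(0,T) × T^d` to be null: conclusion vacuous a.e.
    have h0 : ∀ᵐ t ∂μT, ∀ᵐ x ∂(volume : Measure (UnitAddTorus d)), False := by
      filter_upwards [hθb 0] with t ht
      filter_upwards [ht] with x hx
      exact absurd (hx.trans_lt hH) (not_lt.2 (abs_nonneg _))
    filter_upwards [h0] with t ht
    filter_upwards [ht] with x hx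
    exact hx.elim
  rw [not_lt] at hH
  -- the clamped fields
  set θc : ℕ → ℝ → UnitAddTorus d → ℝ := fun j t x => max (-H) (min H (θ j t x)) with hθc
  have hθu : ∀ j, AEStronglyMeasurable (uncurry (θ j)) P := fun j => by
    rw [hP, hμT, ← volume_restrict_prod_eq]
    exact FunctionSpaces.Torus.aestronglyMeasurable_uncurry_of_stLift_restrict (hθm j)
  have hclamp : Continuous fun v : ℝ => max (-H) (min H v) :=
    continuous_const.max (continuous_const.min continuous_id)
  have hθcu : ∀ j, AEStronglyMeasurable (uncurry (θc j)) P := fun j =>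
    (hclamp.comp_aestronglyMeasurable (hθu j) :
      AEStronglyMeasurable (fun p => max (-H) (min H (uncurry (θ j) p))) P)
  have hθcm : ∀ j, AEStronglyMeasurable (FunctionSpaces.Torus.stLift (θc j)) (volume.restrict (Ioo 0 T ×ˢ univ)) :=
    fun j => by
      have h := hθcu j
      rw [hP, hμT] at h
      exact FunctionSpaces.Torus.aestronglyMeasurable_stLift_of_uncurry h
  -- the clamp is an a.e. modification
  have hθeq : ∀ j, ∀ᵐ p ∂P, θc j p.1 p.2 = θ j p.1 p.2 := by
    intro j
    filter_upwards [ae_prod_abs_le_of_ae_ae (hθu j) (hθb j)] with p hp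
    simp only [hθc]
    rw [min_eq_right (abs_le.1 hp).2, max_eq_right (abs_le.1 hp).1]
  have hθcb : ∀ j, ∀ᵐ t ∂μT, ∀ x, θc j t x ≤ H := fun j =>
    Eventually.of_forall fun t x => max_le (neg_le_self hH) (min_le_left _ _)
  have hθcl : ∀ j, ∀ᵐ t ∂μT, ∀ x, -H ≤ θc j t x := fun j =>
    Eventually.of_forall fun t x => le_max_left _ _
  -- the pairings of the clamped fields are those of the original ones
  have hlimc : ∀ G : ℝ → UnitAddTorus d → ℝ,
      AEStronglyMeasurable (FunctionSpaces.Torus.stLift G) (volume.restrict (Ioo 0 T ×ˢ univ)) →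
      ∫⁻ t in Ioo 0 T, ∫⁻ x, ‖G t x‖ₑ ^ 2 < ⊤ →
      Tendsto (fun j => ∫ t in Ioo 0 T, ∫ x, θc j t x * G t x) atTop (𝓝 (∫ t in Ioo 0 T, ∫ x, W t x * G t x)) := by
    intro G hG1 hG2
    refine (hlim G hG1 hG2).congr fun j => ?_
    refine integral_congr_ae ?_
    filter_upwards [Measure.ae_ae_of_ae_prod (hθeq j)] with t ht
    refine integral_congr_ae ?_
    filter_upwards [ht] with x hx
    rw [hx]
  have hupper := ae_le_of_weakLimit hθcm hθcb hθcl hWm hWb hlimc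
  -- the same for the negated fields
  have hθm' : ∀ j, AEStronglyMeasurable (FunctionSpaces.Torus.stLift (fun t x => -θc j t x))
      (volume.restrict (Ioo 0 T ×ˢ univ)) := fun j => (hθcm j).neg
  have hWm' : AEStronglyMeasurable (FunctionSpaces.Torus.stLift (fun t x => -W t x)) (volume.restrict (Ioo 0 T ×ˢ univ)) :=
    hWm.neg
  have hb1' : ∀ j, ∀ᵐ t ∂μT, ∀ x, (fun t x => -θc j t x) t x ≤ H := fun j =>
    (hθcl j).mono fun t ht x => by simpa using neg_le_neg (ht x)
  have hb2' : ∀ j, ∀ᵐ t ∂μT, ∀ x, -H ≤ (fun t x => -θc j t x) t x := fun j =>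
    (hθcb j).mono fun t ht x => by simpa using neg_le_neg (ht x)
  have hWb' : ∀ᵐ t ∂μT, ∫⁻ x, ‖(fun t x => -W t x) t x‖ₑ ^ 2 ≤ C := by
    filter_upwards [hWb] with t ht
    simpa only [enorm_neg] using ht
  have hWlim' : ∀ G : ℝ → UnitAddTorus d → ℝ,
      AEStronglyMeasurable (FunctionSpaces.Torus.stLift G) (volume.restrict (Ioo 0 T ×ˢ univ)) →
      ∫⁻ t in Ioo 0 T, ∫⁻ x, ‖G t x‖ₑ ^ 2 < ⊤ →
      Tendsto (fun j => ∫ t in Ioo 0 T, ∫ x, (fun t x => -θc j t x) t x * G t x) atTop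
        (𝓝 (∫ t in Ioo 0 T, ∫ x, (fun t x => -W t x) t x * G t x)) := by
    intro G hG1 hG2
    have h1 := (hlimc G hG1 hG2).neg
    have e : ∀ (f : ℝ → UnitAddTorus d → ℝ), -(∫ t in Ioo 0 T, ∫ x, f t x * G t x) =
        ∫ t in Ioo 0 T, ∫ x, (fun t x => -f t x) t x * G t x := by
      intro f
      rw [← integral_neg]
      refine integral_congr_ae (Eventually.of_forall fun t => ?_)
      dsimp only
      rw [← integral_neg]
      exact integral_congr_ae (Eventually.of_forall fun x => by ring)
    simpa only [e] using h1
  have hlower := ae_le_of_weakLimit hθm' hb1' hb2' hWm' hWb' hWlim'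
  filter_upwards [hupper, hlower] with t h1 h2
  filter_upwards [h1, h2] with x hx1 hx2
  have hx2' : -W t x ≤ H := hx2
  exact abs_le.2 ⟨by linarith, hx1⟩

end Bounds

/-! ## Weak lower semicontinuity of the `L²` norm on time slabs -/

section Slab

/-- **Uniform `L²` bounds on a time slab pass to weak limits** (weak lower semicontinuity of the
norm, Brezis 2011, Prop. 3.5 (iii), in the form used by Bagnara–Boutros–De Lellis–Mayboroda 2026,
proof of Thm. 3.1, (3.3)): if `θⱼ ⇀ W` in the sense that `∫∫ θⱼ G → ∫∫ W G` for every space–time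
square-integrable `G` on `(0,T) × T^d` (the fields being uniformly in `L^∞(0,T; L²)`), and
`∫_{(t₁,T)} ∫ θⱼ² ≤ K` for every `j`, then `∫_{(t₁,T)} ∫ W² ≤ K` (`0 ≤ t₁`; test the weak
convergence against `1_{(t₁,T)} W` and use Cauchy–Schwarz on the slab).
[cite: Brezis2011, Prop. 3.5 (iii)] [cite: BagnaraEtAl2026, §3.1 (3.3)] -/
theorem setIntegral_integral_sq_le_of_weakLimit {T t₁ K : ℝ} (ht₁ : 0 ≤ t₁) {C : ℝ≥0}
    {θ : ℕ → ℝ → UnitAddTorus d → ℝ} {W : ℝ → UnitAddTorus d → ℝ}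
    (hθm : ∀ j, AEStronglyMeasurable (FunctionSpaces.Torus.stLift (θ j)) (volume.restrict (Ioo 0 T ×ˢ univ)))
    (hθb : ∀ j, ∀ᵐ t ∂(volume.restrict (Ioo 0 T)), ∫⁻ x, ‖θ j t x‖ₑ ^ 2 ≤ C)
    (hWm : AEStronglyMeasurable (FunctionSpaces.Torus.stLift W) (volume.restrict (Ioo 0 T ×ˢ univ)))
    (hWb : ∀ᵐ t ∂(volume.restrict (Ioo 0 T)), ∫⁻ x, ‖W t x‖ₑ ^ 2 ≤ C)
    (hlim : ∀ G : ℝ → UnitAddTorus d → ℝ,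
      AEStronglyMeasurable (FunctionSpaces.Torus.stLift G) (volume.restrict (Ioo 0 T ×ˢ univ)) →
      ∫⁻ t in Ioo 0 T, ∫⁻ x, ‖G t x‖ₑ ^ 2 < ⊤ →
      Tendsto (fun j => ∫ t in Ioo 0 T, ∫ x, θ j t x * G t x) atTop (𝓝 (∫ t in Ioo 0 T, ∫ x, W t x * G t x)))
    (hK : ∀ j, ∫ t in Ioo t₁ T, ∫ x, θ j t x ^ 2 ≤ K) :
    ∫ t in Ioo t₁ T, ∫ x, W t x ^ 2 ≤ K := by
  set μT : Measure ℝ := (volume : Measure ℝ).restrict (Ioo 0 T) with hμT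
  haveI : IsFiniteMeasure μT := by rw [hμT]; infer_instance
  set P : Measure (ℝ × UnitAddTorus d) := μT.prod volume with hP
  haveI : IsFiniteMeasure P := by rw [hP]; infer_instance
  -- measurability and `L²` membership on the product
  have hWu : AEStronglyMeasurable (uncurry W) P := by
    rw [hP, hμT, ← volume_restrict_prod_eq]
    exact FunctionSpaces.Torus.aestronglyMeasurable_uncurry_of_stLift_restrict hWm
  have hθu : ∀ j, AEStronglyMeasurable (uncurry (θ j)) P := fun j => by
    rw [hP, hμT, ← volume_restrict_prod_eq]
    exact FunctionSpaces.Torus.aestronglyMeasurable_uncurry_of_stLift_restrict (hθm j)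
  have hfinW : ∫⁻ t in Ioo 0 T, ∫⁻ x, ‖W t x‖ₑ ^ 2 < ⊤ :=
    calc ∫⁻ t in Ioo 0 T, ∫⁻ x, ‖W t x‖ₑ ^ 2 ≤ ∫⁻ _ in Ioo (0:ℝ) T, (C : ℝ≥0∞) := lintegral_mono_ae hWb
      _ < ⊤ := by
          rw [lintegral_const, Measure.restrict_apply_univ]
          exact ENNReal.mul_lt_top ENNReal.coe_lt_top measure_Ioo_lt_top
  have hfinθ : ∀ j, ∫⁻ t in Ioo 0 T, ∫⁻ x, ‖θ j t x‖ₑ ^ 2 < ⊤ := fun j =>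
    calc ∫⁻ t in Ioo 0 T, ∫⁻ x, ‖θ j t x‖ₑ ^ 2 ≤ ∫⁻ _ in Ioo (0:ℝ) T, (C : ℝ≥0∞) := lintegral_mono_ae (hθb j)
      _ < ⊤ := by
          rw [lintegral_const, Measure.restrict_apply_univ]
          exact ENNReal.mul_lt_top ENNReal.coe_lt_top measure_Ioo_lt_top
  have hW2 : MemLp (uncurry W) 2 P := (FunctionSpaces.Torus.memLp_two_uncurry hWu hfinW).1
  have hθ2 : ∀ j, MemLp (uncurry (θ j)) 2 P := fun j => (FunctionSpaces.Torus.memLp_two_uncurry (hθu j) (hfinθ j)).1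
  -- the slab indicator and the test field `G = 1_{(t₁,T)} W`
  set χ : ℝ → ℝ := fun t => if t₁ < t then 1 else 0 with hχ
  have hχm : Measurable χ := Measurable.ite measurableSet_Ioi measurable_const measurable_const
  have hχ01 : ∀ t, 0 ≤ χ t ∧ χ t ≤ 1 := fun t => by
    simp only [hχ]; split_ifs <;> norm_num
  have hχsq : ∀ t, χ t * χ t = χ t := fun t => by
    simp only [hχ]; split_ifs <;> norm_num
  set G : ℝ → UnitAddTorus d → ℝ := fun t x => χ t * W t x with hG
  have hGu : AEStronglyMeasurable (uncurry G) P :=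
    ((hχm.comp measurable_fst).aestronglyMeasurable).mul hWu
  have hGW : ∀ p : ℝ × UnitAddTorus d, ‖uncurry G p‖ ≤ ‖uncurry W p‖ := fun p => by
    simp only [uncurry, hG, norm_mul, Real.norm_eq_abs, abs_of_nonneg (hχ01 p.1).1]
    exact mul_le_of_le_one_left (abs_nonneg _) (hχ01 p.1).2
  have hG2 : MemLp (uncurry G) 2 P := hW2.mono hGu (Eventually.of_forall hGW)
  have hGst : AEStronglyMeasurable (FunctionSpaces.Torus.stLift G) (volume.restrict (Ioo 0 T ×ˢ univ)) := by
    have h := hGu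
    rw [hP, hμT] at h
    exact FunctionSpaces.Torus.aestronglyMeasurable_stLift_of_uncurry h
  have hG2' : ∫⁻ t in Ioo 0 T, ∫⁻ x, ‖G t x‖ₑ ^ 2 < ⊤ := by
    refine lt_of_le_of_lt ?_ hfinW
    refine lintegral_mono fun t => lintegral_mono fun x => ?_
    gcongr
    rw [← ofReal_norm, ← ofReal_norm]
    exact ENNReal.ofReal_le_ofReal (hGW (t, x))
  -- slab integrals as product integrals against the time cut-off `χ`
  have hsub : Ioo t₁ T ⊆ Ioo 0 T := Ioo_subset_Ioo_left ht₁
  have hsq_int : ∀ {f : ℝ → UnitAddTorus d → ℝ}, MemLp (uncurry f) 2 P →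
      Integrable (fun p : ℝ × UnitAddTorus d => f p.1 p.2 ^ 2) P := by
    intro f hf
    have := hf.integrable_norm_rpow two_ne_zero ENNReal.ofNat_ne_top
    refine this.congr (Eventually.of_forall fun p => ?_)
    simp only [uncurry, ENNReal.toReal_ofNat, Real.rpow_two, sq_abs, Real.norm_eq_abs]
  have hslab : ∀ {f : ℝ → UnitAddTorus d → ℝ}, MemLp (uncurry f) 2 P →
      ∫ p, χ p.1 * f p.1 p.2 ^ 2 ∂P = ∫ t in Ioo t₁ T, ∫ x, f t x ^ 2 := by
    intro f hf
    have hi : Integrable (fun p : ℝ × UnitAddTorus d => χ p.1 * f p.1 p.2 ^ 2) P := by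
      refine (hsq_int hf).bdd_mul (c := 1) ((hχm.comp measurable_fst).aestronglyMeasurable)
        (Eventually.of_forall fun p => ?_)
      rw [Real.norm_eq_abs, abs_of_nonneg (hχ01 p.1).1]; exact (hχ01 p.1).2
    rw [integral_prod _ hi, hμT]
    have e1 : EqOn (fun t => ∫ x, (fun p : ℝ × UnitAddTorus d => χ p.1 * f p.1 p.2 ^ 2) (t, x))
        ((Ioo t₁ T).indicator fun t => ∫ x, f t x ^ 2) (Ioo 0 T) := by
      intro t ht
      by_cases hlt : t₁ < t
      · have hmem : t ∈ Ioo t₁ T := ⟨hlt, ht.2⟩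
        simp only [indicator_of_mem hmem]
        refine integral_congr_ae (Eventually.of_forall fun x => ?_)
        simp only [hχ, if_pos hlt, one_mul]
      · have hnmem : t ∉ Ioo t₁ T := fun h' => hlt h'.1
        simp only [indicator_of_notMem hnmem]
        simp only [hχ, if_neg hlt, zero_mul, integral_zero]
    rw [setIntegral_congr_fun measurableSet_Ioo e1, integral_indicator measurableSet_Ioo,
      Measure.restrict_restrict measurableSet_Ioo, inter_eq_left.2 hsub]
  -- the weighted fields `Fθ j = χ θⱼ`, `FW = χ W` and their squares
  set FW : ℝ × UnitAddTorus d → ℝ := fun p => χ p.1 * W p.1 p.2 with hFW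
  set Fθ : ℕ → ℝ × UnitAddTorus d → ℝ := fun j p => χ p.1 * θ j p.1 p.2 with hFθ
  have hFWm : MemLp FW 2 P := hG2
  have hFθm : ∀ j, MemLp (Fθ j) 2 P := fun j =>
    (hθ2 j).mono (((hχm.comp measurable_fst).aestronglyMeasurable).mul (hθu j)) (Eventually.of_forall fun p => by
      simp only [uncurry, hFθ, norm_mul, Real.norm_eq_abs, abs_of_nonneg (hχ01 p.1).1]
      exact mul_le_of_le_one_left (abs_nonneg _) (hχ01 p.1).2)
  have hχpow : ∀ (t : ℝ) (v : ℝ), ‖χ t * v‖ ^ (2:ℝ) = χ t * v ^ 2 := fun t v => by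
    rw [Real.rpow_two, Real.norm_eq_abs, sq_abs, mul_pow, sq, hχsq]
  set SW : ℝ := ∫ t in Ioo t₁ T, ∫ x, W t x ^ 2 with hSW
  have hsqW : ∫ p, ‖FW p‖ ^ (2:ℝ) ∂P = SW := by
    rw [hSW, ← hslab hW2]
    exact integral_congr_ae (Eventually.of_forall fun p => hχpow p.1 _)
  have hsqθ : ∀ j, ∫ p, ‖Fθ j p‖ ^ (2:ℝ) ∂P = ∫ t in Ioo t₁ T, ∫ x, θ j t x ^ 2 := by
    intro j
    rw [← hslab (hθ2 j)]
    exact integral_congr_ae (Eventually.of_forall fun p => hχpow p.1 _)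
  -- the limit pairing `∫∫ W G = S_W`
  have hS0 : 0 ≤ SW := by
    rw [hSW]; exact integral_nonneg fun t => integral_nonneg fun x => sq_nonneg _
  have hK0 : 0 ≤ K := (integral_nonneg fun t => integral_nonneg fun x => sq_nonneg _).trans (hK 0)
  have hWG : ∫ t in Ioo 0 T, ∫ x, W t x * G t x = SW := by
    have e1 : (∫ p, W p.1 p.2 * G p.1 p.2 ∂P) = ∫ t in Ioo 0 T, ∫ x, W t x * G t x :=
      integral_prod _ (hW2.integrable_mul hG2)
    rw [← e1, hSW, ← hslab hW2]
    refine integral_congr_ae (Eventually.of_forall fun p => ?_)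
    simp only [hG]; ring
  -- Cauchy–Schwarz on the slab: `∫∫ θⱼ G ≤ √K · √S_W`
  have hCS : ∀ j, ∫ t in Ioo 0 T, ∫ x, θ j t x * G t x ≤ Real.sqrt K * Real.sqrt SW := by
    intro j
    have hi : Integrable (fun p : ℝ × UnitAddTorus d => θ j p.1 p.2 * G p.1 p.2) P := (hθ2 j).integrable_mul hG2
    have hi' : Integrable (fun p : ℝ × UnitAddTorus d => ‖Fθ j p‖ * ‖FW p‖) P :=
      (hFθm j).norm.integrable_mul hFWm.norm
    rw [← integral_prod _ hi]
    have h1 : ∫ p, θ j p.1 p.2 * G p.1 p.2 ∂P ≤ ∫ p, ‖Fθ j p‖ * ‖FW p‖ ∂P := by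
      refine integral_mono hi hi' fun p => ?_
      have e : θ j p.1 p.2 * G p.1 p.2 = Fθ j p * FW p := by
        simp only [hFθ, hFW, hG]
        have := hχsq p.1
        calc θ j p.1 p.2 * (χ p.1 * W p.1 p.2) = (χ p.1) * θ j p.1 p.2 * W p.1 p.2 := by ring
          _ = (χ p.1 * χ p.1) * θ j p.1 p.2 * W p.1 p.2 := by rw [this]
          _ = χ p.1 * θ j p.1 p.2 * (χ p.1 * W p.1 p.2) := by ring
      rw [e, Real.norm_eq_abs, Real.norm_eq_abs, ← abs_mul]
      exact le_abs_self _
    have hp2 : ∀ {f : ℝ × UnitAddTorus d → ℝ}, MemLp f 2 P → MemLp f (ENNReal.ofReal 2) P := fun hf => by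
      rwa [ENNReal.ofReal_ofNat]
    have h2 := integral_mul_norm_le_Lp_mul_Lq Real.HolderConjugate.two_two (hp2 (hFθm j)) (hp2 hFWm)
    rw [hsqθ j, hsqW] at h2
    have h3 : (∫ t in Ioo t₁ T, ∫ x, θ j t x ^ 2) ^ (1 / (2:ℝ)) ≤ Real.sqrt K := by
      rw [Real.sqrt_eq_rpow]
      exact Real.rpow_le_rpow (integral_nonneg fun t => integral_nonneg fun x => sq_nonneg _) (hK j) (by norm_num)
    have h4 : SW ^ (1 / (2:ℝ)) = Real.sqrt SW := by rw [Real.sqrt_eq_rpow]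
    calc ∫ p, θ j p.1 p.2 * G p.1 p.2 ∂P ≤ ∫ p, ‖Fθ j p‖ * ‖FW p‖ ∂P := h1
      _ ≤ (∫ t in Ioo t₁ T, ∫ x, θ j t x ^ 2) ^ (1 / (2:ℝ)) * SW ^ (1 / (2:ℝ)) := h2
      _ ≤ Real.sqrt K * Real.sqrt SW := by
          rw [h4]
          exact mul_le_mul_of_nonneg_right h3 (Real.sqrt_nonneg _)
  -- pass to the limit: `S_W ≤ √K √S_W`, hence `S_W ≤ K`
  have hlimG := hlim G hGst hG2'
  rw [hWG] at hlimG
  have hle : SW ≤ Real.sqrt K * Real.sqrt SW := le_of_tendsto' hlimG hCS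
  by_cases hs : Real.sqrt SW = 0
  · rw [Real.sqrt_eq_zero hS0] at hs
    rw [hs]; exact hK0
  · have hspos : 0 < Real.sqrt SW := lt_of_le_of_ne (Real.sqrt_nonneg _) (Ne.symm hs)
    have h1 : Real.sqrt SW * Real.sqrt SW ≤ Real.sqrt K * Real.sqrt SW := by
      rwa [Real.mul_self_sqrt hS0]
    have h2 : Real.sqrt SW ≤ Real.sqrt K := le_of_mul_le_mul_right h1 hspos
    calc SW = Real.sqrt SW * Real.sqrt SW := (Real.mul_self_sqrt hS0).symm
      _ ≤ Real.sqrt K * Real.sqrt K := mul_le_mul h2 h2 (Real.sqrt_nonneg _) (Real.sqrt_nonneg _)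
      _ = K := Real.mul_self_sqrt hK0

end Slab

end Torus

end Literature.Analysis.FluidPDE

end
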